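import Summits.SmoothPoincare4.SmoothPoincare4.Theorems.DottedCircleRasmussenDcrGfgmw

/-!
# Stub `stub_obstructionShape` of line `Sketch` for crux `DcrGap`
(item stmt-SmoothPoincare4-16128, route route-SmoothPoincare4-DottedCircleRasmussen)

The OBSTRUCTION SHAPE theorem of the line: let `Obs r K` be any property of model circles
`K : 𝕊¹ → ℝ⁴` that fails whenever `K`, resp. its mirror `ρ ∘ K` (`MMSW.modelMirror`), bounds a
model slice disc in `ℝ⁴ ∖ D_r` (`MMSW.IsModelSliceDisc`).  Then ONE model knot `K ⊂ ∂D_r`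
(`MMSW.IsModelKnot r K`) carrying `Obs r K` together with a complement-slice datum `(e, f)` in some
homotopy 4-sphere `M` (`MMSW.IsSliceDiscInComplement r K M e f`) is a one-handle slice gap
(`DottedCircleRasmussen.DcrGap`).

Proof (pure logic over the route's definitions plus the tree's proved standardisation theorem).
`MMSW.IsModelKnot` and `MMSW.IsSliceDiscInComplement` are by definition (`MMSW.isModelKnot_iff`,
`MMSW.isSliceDiscInComplement_iff`, both `Iff.rfl`) the literal binder block and slice datum of
`DcrGap`, so the witness half is the given data.  For the no-disc clause, a datum `(e', f')` in a
smooth `N` with `Φ : N ≃ₘ S⁴` standardises, by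
`DcrGfgmw.exists_isModelSliceDisc_or_mirror_of_diffeomorph` (Palais' disc theorem, proved in
`Theorems/DottedCircleRasmussenDcrGfgmw.lean`), to a model slice disc `g` for `K` or for `ρ ∘ K`;
either vanishing hypothesis then refutes `Obs r K`.

References: R. Palais, *Extending diffeomorphisms*, Proc. AMS 11 (1960), Thm. B [Palais1960];
Manolescu–Marengon–Sarkar–Willis, Duke Math. J. 172 (2023), §8 [ManolescuMarengonSarkarWillis2023].
-/

-- the prescribed namespace `Summit.<P>.<Sub>.…` duplicates `SmoothPoincare4` (P = Sub)
set_option linter.dupNamespace false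

noncomputable section

open scoped Manifold ContDiff Topology
open Literature.Topology.FourManifolds Literature.Topology.FourManifolds.MMSW

namespace Summit.SmoothPoincare4.SmoothPoincare4.Theorems.DcrGap.Sketch

open Summit.SmoothPoincare4.SmoothPoincare4.Theses.DottedCircleRasmussen

/-- **Obstruction shape** (stub `stub_obstructionShape` of line `Sketch`, crux `DcrGap`). Any knot
obstruction `Obs r K` that vanishes whenever `K`, resp. its mirror `ρ ∘ K`, bounds a model slice
disc in `ℝ⁴ ∖ D_r`, together with ONE model knot carrying `Obs` and a complement-slice datum in
some homotopy 4-sphere, gives `DcrGap`: the witness half is the data itself (`MMSW.isModelKnot_iff`,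
`MMSW.isSliceDiscInComplement_iff` are `Iff.rfl`), and a datum in any smooth `N ≅ S⁴` standardises
to a model slice disc for `K` or for `ρ ∘ K`
(`DcrGfgmw.exists_isModelSliceDisc_or_mirror_of_diffeomorph`, Palais), where `Obs` vanishes.
[cite: Palais1960, Thm. B] -/
theorem stub_obstructionShape : ∀ (Obs : (r : ℕ) → ((Metric.sphere (0 : EuclideanSpace ℝ (Fin 2)) 1) → EuclideanSpace ℝ (Fin 4)) → Prop), (∀ (r : ℕ) (K : (Metric.sphere (0 : EuclideanSpace ℝ (Fin 2)) 1) → EuclideanSpace ℝ (Fin 4)) (f : EuclideanSpace ℝ (Fin 2) → EuclideanSpace ℝ (Fin 4)), Literature.Topology.FourManifolds.MMSW.IsModelSliceDisc r K f → ¬ Obs r K) → (∀ (r : ℕ) (K : (Metric.sphere (0 : EuclideanSpace ℝ (Fin 2)) 1) → EuclideanSpace ℝ (Fin 4)) (f : EuclideanSpace ℝ (Fin 2) → EuclideanSpace ℝ (Fin 4)), Literature.Topology.FourManifolds.MMSW.IsModelSliceDisc r (Literature.Topology.FourManifolds.MMSW.modelMirror ∘ K) f → ¬ Obs r K) → (∃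 (r : ℕ) (K : (Metric.sphere (0 : EuclideanSpace ℝ (Fin 2)) 1) → EuclideanSpace ℝ (Fin 4)), Literature.Topology.FourManifolds.MMSW.IsModelKnot r K ∧ Obs r K ∧ ∃ (M : Type) (_ : TopologicalSpace M) (_ : T2Space M) (_ : SecondCountableTopology M) (_ : ChartedSpace (EuclideanSpace ℝ (Fin 4)) M) (_ : IsManifold (𝓡 4) ((⊤ : ℕ∞) : WithTop ℕ∞) M), Nonempty (ContinuousMap.HomotopyEquiv M (Metric.sphere (0 : EuclideanSpace ℝ (Fin 5)) 1)) ∧ ∃ (e : EuclideanSpace ℝ (Fin 4) → M) (f : EuclideanSpace ℝ (Fin 2) → M), Literature.Topology.FourManifolds.MMSW.IsSliceDiscInComplement r K M e f) → Summit.SmoothPoincare4.SmoothPoincare4.Theses.DottedCircleRasmussen.DcrGap := by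
  intro Obs hW hWm h
  obtain ⟨r, K, hK, hObs, M, i1, i2, i3, i4, i5, hM, e, f, hf⟩ := h
  unfold DcrGap
  refine ⟨r, K, (MMSW.isModelKnot_iff K).1 hK,
    ⟨M, i1, i2, i3, i4, i5, hM, e, f, (MMSW.isSliceDiscInComplement_iff K M e f).1 hf⟩, ?_⟩
  intro N _ _ _ _ _ hN e' f' h'
  obtain ⟨Φ⟩ := hN
  obtain ⟨g, hg | hg⟩ :=
    DcrGfgmw.exists_isModelSliceDisc_or_mirror_of_diffeomorph (fun t => hK.mem t) Φ
      ((MMSW.isSliceDiscInComplement_iff K N e' f').2 h')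
  · exact hW r K g hg hObs
  · exact hWm r K g hg hObs

end Summit.SmoothPoincare4.SmoothPoincare4.Theorems.DcrGap.Sketch

end
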